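import Literature.MathematicalPhysics.QuantumFieldTheory.Balaban1983to89.B12Eq311CurrentExpansion
import Literature.MathematicalPhysics.QuantumFieldTheory.Balaban1983to89.B11Eq135Weitzenbock

/-!
# `Balaban1983to89.B12Eq311Landau` — T. Bałaban, *Renormalization group approach to lattice gauge field theories. I*,
Commun. Math. Phys. **109** (1987) 249–301 [Balaban1987RG1]: **the Landau-gauge replacement behind (3.11)–(3.13)**, p. 272: *«It is the
term D^{ξ*}_U D^ξ_U 𝐀 in this formula which is a source of a trouble. … We use the fact that H_k satisfies the Landau gauge condition
R D^{ξ*} H_k = 0, and we replace the operator D*D by D*D + DRD* = D*D + DD* − DPD* = Δ^ξ_U − P₁ + (lower order, local operator).»*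
TYPED AND PROVED as the bridge between the first-order term `D^{ξ*}_V π D^ξ_V 𝐀` of (3.11) (`B12Eq311CurrentExpansion.lapπ` / `lapCur`)
and the lattice Weitzenböck identity (135) of [15] IN THE TREE (`B11Eq135Weitzenbock.eq135η`: `D^{ξ*}D^ξ + D^ξD^{ξ*} = Δ^ξ_U − ξ⁻²𝒦`,
`𝒦 = curvOp` the curvature operator, bounded by `norm_curvOp_le_eps` — the «lower order, local operator»): under the Landau condition
`R(ξ⁻¹D^{ξ*}𝐀) = 0` (`R`, `P` any maps of site fields with `R + P = I`, as in `B11Eq135Weitzenbock.eq134`; [5] (3.25) and `P := I − R`)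
`D^{ξ*}_V D^ξ_V 𝐀 = Δ^ξ_V 𝐀 − ξ⁻²𝒦𝐀 − D^ξ P ξ⁻¹D^{ξ*} 𝐀` bondwise (`landau_replacement`; print's `P₁` = `D^ξ P ξ⁻¹D^{ξ*}`), and the
same inside `π` for the (3.11) term (`lapπ_eq_pi`: a `π` commuting with the transports comes out of `D^{ξ*}_V`; `lapπ_landau`; on the
torus `lapCur_landau` with the commuting of the shifts discharged by `B9TorusCalculus.torusT_comm`).

HONEST FRAMING (cell `lit-balaban`, verbatim): statement-level skeleton of published theorems with citation tags; proofs where landed; nothing here is a claim about the Yang–Mills mass gap.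

PDF held: `paper:balaban1987-cmp109-rg-i-small-field` (journal page = PDF page + 248); p. 272 re-read by this unit; [15] = [Balaban1985Variational]
p. 298 ((134)–(135)) read as the render `b2b-balaban-ref1/pages/1985-cmp102-variational-background/…-p022-x2.png`.

HONEST SCOPE.  (a) The identity is algebra over (135): with `R g = 0`, `g = ξ⁻¹D^{ξ*}𝐀`, one has `P g = g`, so `D^ξ P g = D^ξD^{ξ*}𝐀` and
`D^{ξ*}D^ξ𝐀 = (D^{ξ*}D^ξ + D^ξD^{ξ*})𝐀 − D^ξ P g`; nothing about WHICH `R` (the print's is `R(U_k)` of (180) [15] / [5] (3.25)) is used.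
(b) `Δ^ξ_V` is [5] (3.23) `B9Eq352ScalarFluct.siteLap` on each component `x ↦ 𝐀_μ(x)` (as in `B11Eq135Weitzenbock`); the bound on `𝒦` and on
`P₁` («we will have good bounds, including bounds for the covariant Laplace operator») stay by reference (`B11Eq135Weitzenbock.norm_curvOp_le_eps`,
[5] (3.49)).  (c) Commuting unit translations are a hypothesis on the abstract lattice (`hT`), a theorem on the torus.  No definition, no
`Prop` placeholder, no new fact; axioms standard.  Unit `lit-balaban-p07` (Phase-2 seat p07 gen 7; row B12.Eq3.10-3.12, owners r09/r20),
HOME `run/shared/lean/pub/lit-balaban/`.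
-/

open NormedSpace Complex

namespace Literature.MathematicalPhysics.QuantumFieldTheory.Balaban1983to89.B12Eq311Landau

open Literature.MathematicalPhysics.QuantumFieldTheory.Balaban1983to89
open Literature.MathematicalPhysics.QuantumFieldTheory.Balaban1983to89.B9Eq39Adjoint
open Literature.MathematicalPhysics.QuantumFieldTheory.Balaban1983to89.B9TorusCalculus
open Literature.MathematicalPhysics.QuantumFieldTheory.Balaban1983to89.B9Eq352ScalarFluct (siteLap)
open Literature.MathematicalPhysics.QuantumFieldTheory.Balaban1983to89.B9Eq3117Current (covDη covDη_apply)
open Literature.MathematicalPhysics.QuantumFieldTheory.Balaban1983to89.B11Eq135Weitzenbock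
open Literature.MathematicalPhysics.QuantumFieldTheory.Balaban1983to89.B12Eq311CurrentExpansion

noncomputable section

/-! ## §1. `π` comes out of `D^{ξ*}_V`; the replacement on the abstract lattice -/

section Abstract

variable {𝔸 : Type*} [NormedRing 𝔸] [NormedAlgebra ℂ 𝔸] {S : Type*} {ι : Type*}
variable (T : ι → Equiv.Perm S) (V : ι → S → 𝔸ˣ)

/-- A `ℂ`-linear `π` commuting with the transports `Ad(V(b)⁻¹)` commutes with the adjoint covariant derivative (3.8)/(3.9) [5]:
`D¹*_ν(π ∘ G)(x) = π(D¹*_νG(x))`. [cite: Balaban1985BackgroundPropagators, (3.9) p.392] -/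
theorem covDstar_pi (π : 𝔸 →ₗ[ℂ] 𝔸) (hπR : ∀ μ x X, π (R (V μ x)⁻¹ X) = R (V μ x)⁻¹ (π X)) (ν : ι) (G : S → 𝔸) (x : S) :
    covDstar T V ν (fun y => π (G y)) x = π (covDstar T V ν G x) := by
  simp only [covDstar, map_sub, hπR]

variable [Fintype ι] [LinearOrder ι]

/-- … hence with the divergence (3.9) [5] on plaquette functions: `D*(π ∘ F)_μ(x) = π((D*F)_μ(x))`.
[cite: Balaban1985BackgroundPropagators, (3.9) p.392] -/
theorem divP_pi (π : 𝔸 →ₗ[ℂ] 𝔸) (hπR : ∀ μ x X, π (R (V μ x)⁻¹ X) = R (V μ x)⁻¹ (π X)) (F : ι → ι → S → 𝔸) (μ : ι) (x : S) :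
    divP T V (fun κ ν y => π (F κ ν y)) μ x = π (divP T V F μ x) := by
  have hite : ∀ (c : Prop) [Decidable c] (X : 𝔸), (if c then π X else 0) = π (if c then X else 0) := fun c _ X => by
    split_ifs <;> simp
  simp only [divP, covDstar_pi T V π hπR, hite, map_sub, map_sum]

/-- **The first-order term of (3.11) with `π` outside**: for `π` commuting with the transports,
`D^{ξ*}_V π D^ξ_V 𝐀 = π(D^{ξ*}_V D^ξ_V 𝐀)` bondwise. [cite: Balaban1987RG1, (3.11) p.272] -/
theorem lapπ_eq_pi (π : 𝔸 →ₗ[ℂ] 𝔸) (ξ : ℝ) (A : ι → S → 𝔸)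
    (hπR : ∀ μ x X, π (R (V μ x)⁻¹ X) = R (V μ x)⁻¹ (π X)) (μ : ι) (x : S) :
    lapπ T π ξ V A μ x = π (divPη T V ξ (curlη T V ξ A) μ x) := by
  simp only [lapπ, divPη, map_smul, divP_pi T V π hπR]

/-- **[B12 p. 272] the Landau-gauge replacement `D*D → D*D + DRD* = D*D + DD* − DPD* = Δ^ξ_U − P₁ + (lower order, local operator)`**,
PROVED on the abstract lattice with commuting unit translations: for a bond field `𝐀` satisfying the Landau gauge condition
`R(ξ⁻¹D^{ξ*}𝐀) = 0` (`R + P = I`),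
`(D^{ξ*}_V D^ξ_V 𝐀)_μ(x) = (Δ^ξ_V 𝐀_μ)(x) − ξ⁻²(𝒦𝐀)_μ(x) − (D^ξ_μ P ξ⁻¹D^{ξ*}𝐀)(x)` — `Δ^ξ_V` = [5] (3.23) (`siteLap`) on each component,
`𝒦` = the curvature operator of (135) [15] (`B11Eq135Weitzenbock.curvOp`, the «lower order, local operator»), `P₁ = D^ξ P ξ⁻¹D^{ξ*}`.
[cite: Balaban1987RG1, (3.11)–(3.13) p.272; Balaban1985Variational, (134)–(135) p.298] -/
theorem landau_replacement (hT : ∀ μ ν x, T μ (T ν x) = T ν (T μ x)) (ξ : ℝ) (Rop Pop : (S → 𝔸) → (S → 𝔸))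
    (hRP : ∀ f : S → 𝔸, Rop f + Pop f = f) (A : ι → S → 𝔸) (hL : Rop (fun y => ((ξ : ℂ)⁻¹) • divB T V A y) = 0)
    (μ : ι) (x : S) :
    divPη T V ξ (curlη T V ξ A) μ x
      = siteLap T V ξ (A μ) x - (((ξ : ℂ)⁻¹) ^ 2) • curvOp T V A μ x
        - covDη T V ξ (Pop (fun y => ((ξ : ℂ)⁻¹) • divB T V A y)) μ x := by
  have hP : Pop (fun y => ((ξ : ℂ)⁻¹) • divB T V A y) = fun y => ((ξ : ℂ)⁻¹) • divB T V A y := by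
    have h := hRP (fun y => ((ξ : ℂ)⁻¹) • divB T V A y)
    rwa [hL, zero_add] at h
  rw [hP, eq_sub_iff_add_eq, eq135η T V hT ξ A μ x, curvOp_def]

/-- **The replacement inside the (3.11) term**: for `π` commuting with the transports and `𝐀` in the Landau gauge `R(ξ⁻¹D^{ξ*}𝐀) = 0`,
`D^{ξ*}_V π D^ξ_V 𝐀 = π(Δ^ξ_V 𝐀 − ξ⁻²𝒦𝐀 − D^ξ P ξ⁻¹D^{ξ*}𝐀)` bondwise. [cite: Balaban1987RG1, (3.11)–(3.13) p.272; Balaban1985Variational, (135) p.298] -/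
theorem lapπ_landau (hT : ∀ μ ν x, T μ (T ν x) = T ν (T μ x)) (π : 𝔸 →ₗ[ℂ] 𝔸) (ξ : ℝ)
    (hπR : ∀ μ x X, π (R (V μ x)⁻¹ X) = R (V μ x)⁻¹ (π X)) (Rop Pop : (S → 𝔸) → (S → 𝔸))
    (hRP : ∀ f : S → 𝔸, Rop f + Pop f = f) (A : ι → S → 𝔸) (hL : Rop (fun y => ((ξ : ℂ)⁻¹) • divB T V A y) = 0)
    (μ : ι) (x : S) :
    lapπ T π ξ V A μ x
      = π (siteLap T V ξ (A μ) x - (((ξ : ℂ)⁻¹) ^ 2) • curvOp T V A μ x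
          - covDη T V ξ (Pop (fun y => ((ξ : ℂ)⁻¹) • divB T V A y)) μ x) := by
  rw [lapπ_eq_pi T V π ξ A hπR, landau_replacement T V hT ξ Rop Pop hRP A hL]

end Abstract

/-! ## §2. On the torus (commuting shifts discharged) -/

section Torus

variable {P : Params} {i : ℕ} {𝔸 : Type*} [NormedRing 𝔸] [NormedAlgebra ℂ 𝔸]

/-- **[B12 p. 272] the Landau-gauge replacement on the torus `T^{(i)}`**: for bond variables `U`, a bond field `𝐀` with
`R(ξ⁻¹D^{ξ*}𝐀) = 0` (`R + P = I`) and `π` commuting with the transports, the first-order term of (3.11) is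
`(D^{ξ*}_U π D^ξ_U 𝐀)(b) = π((Δ^ξ_U 𝐀_μ)(x) − ξ⁻²(𝒦𝐀)_μ(x) − (D^ξ_μ P ξ⁻¹D^{ξ*}𝐀)(x))`, `b = ⟨x, x + e_μ⟩` (`B12Eq311CurrentExpansion.lapCur`
in the letters of `B11Eq135Weitzenbock` / `B9Eq352ScalarFluct.siteLap` on the direction form `B12Eq18Current.dirForm`).
[cite: Balaban1987RG1, (3.11)–(3.13) p.272; Balaban1985Variational, (135) p.298] -/
theorem lapCur_landau (π : 𝔸 →ₗ[ℂ] 𝔸) (ξ : ℝ) (U : PBond P i → 𝔸ˣ) (A : PBond P i → 𝔸)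
    (hπR : ∀ b X, π (R (U b)⁻¹ X) = R (U b)⁻¹ (π X)) (Rop Pop : (Site P i → 𝔸) → (Site P i → 𝔸))
    (hRP : ∀ f : Site P i → 𝔸, Rop f + Pop f = f)
    (hL : Rop (fun y => ((ξ : ℂ)⁻¹) • divB (torusT P i) (B12Eq18Current.dirForm U) (B12Eq18Current.dirForm A) y) = 0)
    (b : PBond P i) :
    lapCur π ξ U A b
      = π (siteLap (torusT P i) (B12Eq18Current.dirForm U) ξ (B12Eq18Current.dirForm A b.dir) b.src
          - (((ξ : ℂ)⁻¹) ^ 2) • curvOp (torusT P i) (B12Eq18Current.dirForm U) (B12Eq18Current.dirForm A) b.dir b.src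
          - covDη (torusT P i) (B12Eq18Current.dirForm U) ξ
              (Pop (fun y => ((ξ : ℂ)⁻¹) • divB (torusT P i) (B12Eq18Current.dirForm U) (B12Eq18Current.dirForm A) y))
              b.dir b.src) :=
  lapπ_landau (torusT P i) (B12Eq18Current.dirForm U) torusT_comm π ξ (fun μ x X => hπR ⟨x, μ⟩ X) Rop Pop hRP
    (B12Eq18Current.dirForm A) hL b.dir b.src

end Torus

end

end Literature.MathematicalPhysics.QuantumFieldTheory.Balaban1983to89.B12Eq311Landau
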